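import Mathlib.LinearAlgebra.Dimension.Finrank
import Mathlib.LinearAlgebra.FiniteDimensional.Defs
import Mathlib.LinearAlgebra.FiniteDimensional.Lemmas
import Mathlib.Algebra.Group.Nat.Even
import Summits.BirchSwinnertonDyer.BirchSwinnertonDyer.Theses.KolyvaginRoadThree
import HarnessLib

/-!
# Route `KolyvaginRoadThree`, deciding crux `ZhangSharpFrameAtThreeHL` (item stmt-BirchSwinnertonDyer-19574):
# W. Zhang's INDUCTION (Camb. J. Math. 2 (2014), §9, proof of Thm 9.1) as a kernel theorem of pure linear algebra —
# the `p`-uniform composition engine of a METHOD skeleton for Kolyvagin's conjecture mod `p`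
# (cell `bsd-stepL`, seat `bsd-stepL-zhang3-p1` g4; `--supports stmt-BirchSwinnertonDyer-19574`, helper; planner KOLY-(1) input)

HONEST FRAMING. Nothing about elliptic curves, Heegner points or `p = 3` is asserted: this file isolates the
COMBINATORIAL HEART of W. Zhang's proof of Kolyvagin's conjecture — the induction on the Selmer rank in the proof of
his Thm 9.1 (pp. 240–242) — as a theorem about finite-dimensional vector spaces over an arbitrary field, with every
number-theoretic input of the proof entering as an explicitly named HYPOTHESIS SHAPE. The point for the route: the
judge's chip `skeleton-is-locus-split` on 19574 asks for a METHOD skeleton; in today's tree vocabulary every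
`by_cases` skeleton of the crux is a locus cut (the crux is the class record's missing lower half on A1, p441688), and
Zhang's method needs objects the tree does not have (level-raised newforms `g_n`, `Sel_𝔭(A_{g_n}/K)`, admissible
primes, Bertolini–Darmon local conditions). Abstracting those objects to DATA — for each finite set `n` of
«admissible primes» two eigen-Selmer subspaces `Sel n ±` of one ambient space `H` (Zhang's `k₀`-rational Selmer groups
`Sel_{𝔭_n,0}(A_n/K)^± ⊂ H¹(K, V)`), relaxed versions `SelRel n B ±`, a base locus `B n`, and classes `κ m n ∈ H`
(the Kolyvagin classes `c(m, n)` of the level-`n` Shimura curve) — the induction goes through VERBATIM from six axiom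
shapes, uniformly in the field (so in `p`; Zhang prints `p ≥ 5` for his INPUTS, not for this step):

* (A1) RANK LOWERING [Zhang Prop. 5.4 with the level-raising Thm. 2.1 (Bertolini–Darmon ∕ Diamond–Taylor) at a prime
  chosen by Čebotarev, (9.1)–(9.2)]: a non-zero `c ∈ Sel n μ` is killed by raising the level at some `q ∉ n`, the
  `μ`-part dropping by exactly one dimension inside `Sel n μ` and the `−μ`-part unchanged;
* (A2) CONGRUENCE TRANSPORT [Thm. 4.3, «cohomological congruence of Heegner points», read contrapositively]:
  if `q₂` is not a base point of the system at level `n q₁ q₂` then some class at level `n` is non-zero;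
* (A3) TRIANGULATION [Lemma 8.4]: at an even level carrying a non-zero class, for some sign `s` and some `d`,
  `dim Sel^s = d + 1`, `Sel^s = Sel^s_B` (relaxed at the base locus) and `dim Sel^{−s}_B ≤ d`;
* (A4) RELAXATION [(9.3)]: the local conditions at levels `n` and `n ∪ {q}` differ only at `q`, so `Sel n ≤ SelRel
  (n ∪ {q}) B` whenever `q ∈ B`;
* (A5) BASE CASE [Thm. 7.2: Selmer rank one ⟹ `c(1) ≠ 0`, via the rank-0 converse (Skinner–Urban ∕ Kato) for the
  level-raised form and the Jochnowitz congruence];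
* (A6) PARITY [Thm. 9.2 ∕ Gross–Parson Lemma 9 ∕ Nekovář]: the Selmer rank at an even level is odd.

THEOREM (`exists_ne_zero_of_zhangInduction`): under (A1)–(A6), at EVERY even level some class is non-zero — in
particular at level `∅` (the curve one started with): Zhang's Thm 9.1 `κ ≠ 0`, as a consequence of its inputs.
For 19574 this is the SEQUENTIAL composition `(∃ datum satisfying (A1)–(A6) whose level-∅ classes are the concrete
Kolyvagin classes d.kolyvaginClass) → crux`; the stub «∃ datum at p = 3, 3 ∥ N on the HL frames of A1» is exactly the
cell's memo chain (koly MEMO-v2…v6: u-admissible level raising for (A1), mod-3 multiplicity one ∕ Ihara for (A2),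
R-SU3 + B♭ for (A5)–(A6), Gross–McCallum Kolyvagin-system relations + Čebotarev for (A3)) and is NOT claimed here.
The same engine serves the p ≥ 5 audit of Skinner–Zhang 2014 Thm 1.3 (POST-1a-BRIEF row 2), where the datum IS print.
PARTITION: O2@3 (B10) × A1 — none (composition engine; types nothing, closes nothing). 0 defs, 0 facts, 0 `sorry`.

References: [cite: WZhang2014, §9 proof of Thm. 9.1 (pp. 240–242), Lemma 8.4, Prop. 5.4, Thm. 4.3, Thm. 7.2, Thm. 9.2]
[cite: Howard2006Bipartite, §2.2–§2.3 (bipartite Euler systems)] [cite: BertoliniDarmon2005, §2–§4].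
-/

namespace Summit.BirchSwinnertonDyer.Rank1Residual.X11b.Three.Koly.ZhangInduction

open Module

variable {F : Type*} [Field F] {H : Type*} [AddCommGroup H] [Module F H]
  {Q : Type*} [DecidableEq Q] {M : Type*}

/-- A submodule of positive dimension has a non-zero element. [folklore] -/
private theorem exists_mem_ne_zero_of_finrank_pos {S : Submodule F H} (h : 0 < finrank F S) :
    ∃ c ∈ S, c ≠ 0 := by
  by_contra hc
  push Not at hc
  have hbot : S = ⊥ := (Submodule.eq_bot_iff S).mpr hc
  rw [hbot, finrank_bot] at h
  exact lt_irrefl 0 h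

omit [DecidableEq Q] in
/-- The total rank does not depend on which eigenspace is listed first. [folklore] -/
private theorem rank_symm (Sel : Finset Q → Bool → Submodule F H) (n : Finset Q) (μ : Bool) :
    finrank F (Sel n μ) + finrank F (Sel n (!μ)) = finrank F (Sel n true) + finrank F (Sel n false) := by
  cases μ
  · rw [Bool.not_false, add_comm]
  · rw [Bool.not_true]

set_option maxHeartbeats 400000 in
/-- **W. Zhang's induction (Camb. J. Math. 2 (2014), proof of Thm. 9.1) as pure linear algebra.** Data: an ambient
`F`-space `H` (not assumed finite-dimensional — `H¹(K, V)` is not; only the relaxed Selmer spaces are, `hfin`); for every finite set `n` of admissible primes the two eigen-Selmer spaces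
`Sel n μ ⊆ H` (`μ : Bool` the sign of complex conjugation), their relaxations `SelRel n B μ` at a set `B` of primes,
the base locus `B n` of the Kolyvagin system of level `n`, and the classes `κ m n ∈ H` (`m : M` the Kolyvagin level,
`m₁` the trivial one). Hypotheses = the printed shapes (module docstring): (A1) rank lowering `hA1`, (A2) congruence
transport `hA2`, (A3) triangulation `hA3`, (A4) relaxation `hA4`, (A5) base case `hA5`, (A6) parity `hA6`.
Conclusion: at every level `n` of even cardinality some class `κ m n` is non-zero. Proof = Zhang's, verbatim: pick the
larger eigenspace `μ` (parity), lower the rank twice inside it (A1) to an even level `n q₁ q₂` of rank `r − 2`, apply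
the induction hypothesis there, and transport back by (A2) unless `q₂` is a base point — which (A3) + (A4) exclude in
both cases `s = μ` (the killed class `c₂` would survive) and `s = −μ` (dimension count (9.1)–(9.4)). Uniform in `F`;
no hypothesis on any prime. [cite: WZhang2014, §9 proof of Thm. 9.1, Lemma 8.4, Prop. 5.4, Thm. 4.3, Thm. 7.2, Thm. 9.2] -/
theorem exists_ne_zero_of_zhangInduction
    (Sel : Finset Q → Bool → Submodule F H) (SelRel : Finset Q → Set Q → Bool → Submodule F H)
    (B : Finset Q → Set Q) (κ : M → Finset Q → H) (m₁ : M)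
    -- the relaxed Selmer groups are finite-dimensional (`H = H¹(K, V)` itself is not)
    (hfin : ∀ (n : Finset Q) (S : Set Q) (μ : Bool), FiniteDimensional F (SelRel n S μ))
    -- (A1) rank lowering at a Čebotarev prime, eigen-bookkeeping (9.1)–(9.2)
    (hA1 : ∀ (n : Finset Q) (μ : Bool) (c : H), c ∈ Sel n μ → c ≠ 0 →
      ∃ q, q ∉ n ∧ c ∉ Sel (insert q n) μ ∧ Sel (insert q n) μ ≤ Sel n μ ∧
        finrank F (Sel (insert q n) μ) + 1 = finrank F (Sel n μ) ∧ Sel (insert q n) (!μ) = Sel n (!μ))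
    -- (A2) cohomological congruence, contrapositive form: q₂ off the base locus upstairs ⟹ a non-zero class downstairs
    (hA2 : ∀ (n : Finset Q) (q₁ q₂ : Q), q₁ ∉ n → q₂ ∉ insert q₁ n →
      q₂ ∉ B (insert q₂ (insert q₁ n)) → ∃ m, κ m n ≠ 0)
    -- (A3) triangulation of the Selmer group at an even level with a non-zero class
    (hA3 : ∀ (n : Finset Q), Even n.card → (∃ m, κ m n ≠ 0) →
      ∃ (s : Bool) (d : ℕ), finrank F (Sel n s) = d + 1 ∧ Sel n s = SelRel n (B n) s ∧
        finrank F (SelRel n (B n) (!s)) ≤ d)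
    -- (A4) relaxation: levels n and n ∪ {q} differ only at q
    (hA4 : ∀ (n : Finset Q) (q : Q) (S : Set Q) (s : Bool), q ∉ n → q ∈ S → Sel n s ≤ SelRel (insert q n) S s)
    -- (A5) base case: Selmer rank one
    (hA5 : ∀ (n : Finset Q), Even n.card → finrank F (Sel n true) + finrank F (Sel n false) = 1 → κ m₁ n ≠ 0)
    -- (A6) parity
    (hA6 : ∀ (n : Finset Q), Even n.card → Odd (finrank F (Sel n true) + finrank F (Sel n false))) :
    ∀ (n : Finset Q), Even n.card → ∃ m, κ m n ≠ 0 := by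
  -- strong induction on the Selmer rank `r n = dim Sel⁺ + dim Sel⁻`
  suffices hmain : ∀ (k : ℕ) (n : Finset Q), finrank F (Sel n true) + finrank F (Sel n false) = k →
      Even n.card → ∃ m, κ m n ≠ 0 from fun n hn ↦ hmain _ n rfl hn
  intro k
  induction k using Nat.strong_induction_on with
  | _ k ih =>
    intro n hk hn
    have hodd := hA6 n hn
    by_cases h1 : finrank F (Sel n true) + finrank F (Sel n false) = 1
    · exact ⟨m₁, hA5 n hn h1⟩
    -- r ≥ 3; choose the larger eigenspace μ
    have h3 : 3 ≤ finrank F (Sel n true) + finrank F (Sel n false) := by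
      obtain ⟨t, ht⟩ := hodd
      omega
    obtain ⟨μ, hμ⟩ : ∃ μ : Bool, finrank F (Sel n (!μ)) < finrank F (Sel n μ) := by
      by_cases hlt : finrank F (Sel n false) < finrank F (Sel n true)
      · exact ⟨true, by rw [Bool.not_true]; exact hlt⟩
      · refine ⟨false, ?_⟩
        have hne : finrank F (Sel n true) ≠ finrank F (Sel n false) := by
          intro heq
          obtain ⟨t, ht⟩ := hodd
          omega
        rw [Bool.not_false]
        omega
    have hsum := rank_symm Sel n μ
    have hμ2 : 2 ≤ finrank F (Sel n μ) := by omega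
    -- first rank lowering, at q₁
    obtain ⟨c₁, hc₁, hc₁0⟩ := exists_mem_ne_zero_of_finrank_pos (S := Sel n μ) (by omega)
    obtain ⟨q₁, hq₁n, -, -, hrk₁, hneg₁⟩ := hA1 n μ c₁ hc₁ hc₁0
    -- second rank lowering, at q₂, killing a non-zero c₂ ∈ Sel (n ∪ {q₁}) μ
    obtain ⟨c₂, hc₂, hc₂0⟩ := exists_mem_ne_zero_of_finrank_pos (S := Sel (insert q₁ n) μ) (by omega)
    obtain ⟨q₂, hq₂n, hc₂out, hle₂, hrk₂, hneg₂⟩ := hA1 (insert q₁ n) μ c₂ hc₂ hc₂0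
    set n₁ := insert q₁ n with hn₁
    set n₂ := insert q₂ n₁ with hn₂
    -- the new level is even, of rank r − 2
    have hcard : n₂.card = n.card + 2 := by
      rw [hn₂, Finset.card_insert_of_notMem hq₂n, hn₁, Finset.card_insert_of_notMem hq₁n]
    have hn₂even : Even n₂.card := by
      obtain ⟨t, ht⟩ := hn
      exact ⟨t + 1, by rw [hcard]; omega⟩
    have hsum₂ := rank_symm Sel n₂ μ
    have hrank₂ : finrank F (Sel n₂ true) + finrank F (Sel n₂ false) + 2 = k := by
      rw [← hsum₂, hneg₂, hneg₁, ← hk, ← hsum]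
      omega
    obtain ⟨m', hm'⟩ := ih _ (by omega) n₂ rfl hn₂even
    -- transport down by (A2) unless q₂ is a base point of the level-n₂ system
    refine hA2 n q₁ q₂ hq₁n hq₂n fun hq₂B ↦ ?_
    obtain ⟨s, d, hs1, hs2, hs3⟩ := hA3 n₂ hn₂even ⟨m', hm'⟩
    by_cases hsμ : s = μ
    · -- case (1): the killed class c₂ would lie in Sel n₂ μ
      subst hsμ
      have hincl : Sel n₁ s ≤ SelRel n₂ (B n₂) s := hA4 n₁ q₂ (B n₂) s hq₂n hq₂B
      exact hc₂out (hs2 ▸ hincl hc₂)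
    · -- case (2): dimension count
      have hs : s = !μ := by cases s <;> cases μ <;> simp_all
      subst hs
      have hincl : Sel n₁ μ ≤ SelRel n₂ (B n₂) μ := hA4 n₁ q₂ (B n₂) μ hq₂n hq₂B
      haveI := hfin n₂ (B n₂) μ
      have hle : finrank F (Sel n₁ μ) ≤ finrank F (SelRel n₂ (B n₂) μ) := Submodule.finrank_mono hincl
      have hs3' : finrank F (SelRel n₂ (B n₂) μ) ≤ d := by rw [Bool.not_not] at hs3; exact hs3
      -- dim Sel n₂ (−μ) = dim Sel n (−μ) = d + 1, dim Sel n₁ μ = dim Sel n μ − 1 ≤ d: contradicts μ larger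
      rw [hneg₂, hneg₁] at hs1
      omega

/-- **At the bottom level** (the form one starts with, `n = ∅`): under (A1)–(A6) some Kolyvagin class `κ m ∅` is
non-zero — Zhang's Thm. 9.1 `κ ≠ 0` as a consequence of its six inputs, uniformly in the field of coefficients.
[cite: WZhang2014, Thm. 9.1] -/
theorem exists_ne_zero_at_bottom_of_zhangInduction
    (Sel : Finset Q → Bool → Submodule F H) (SelRel : Finset Q → Set Q → Bool → Submodule F H)
    (B : Finset Q → Set Q) (κ : M → Finset Q → H) (m₁ : M)
    (hfin : ∀ (n : Finset Q) (S : Set Q) (μ : Bool), FiniteDimensional F (SelRel n S μ))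
    (hA1 : ∀ (n : Finset Q) (μ : Bool) (c : H), c ∈ Sel n μ → c ≠ 0 →
      ∃ q, q ∉ n ∧ c ∉ Sel (insert q n) μ ∧ Sel (insert q n) μ ≤ Sel n μ ∧
        finrank F (Sel (insert q n) μ) + 1 = finrank F (Sel n μ) ∧ Sel (insert q n) (!μ) = Sel n (!μ))
    (hA2 : ∀ (n : Finset Q) (q₁ q₂ : Q), q₁ ∉ n → q₂ ∉ insert q₁ n →
      q₂ ∉ B (insert q₂ (insert q₁ n)) → ∃ m, κ m n ≠ 0)
    (hA3 : ∀ (n : Finset Q), Even n.card → (∃ m, κ m n ≠ 0) →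
      ∃ (s : Bool) (d : ℕ), finrank F (Sel n s) = d + 1 ∧ Sel n s = SelRel n (B n) s ∧
        finrank F (SelRel n (B n) (!s)) ≤ d)
    (hA4 : ∀ (n : Finset Q) (q : Q) (S : Set Q) (s : Bool), q ∉ n → q ∈ S → Sel n s ≤ SelRel (insert q n) S s)
    (hA5 : ∀ (n : Finset Q), Even n.card → finrank F (Sel n true) + finrank F (Sel n false) = 1 → κ m₁ n ≠ 0)
    (hA6 : ∀ (n : Finset Q), Even n.card → Odd (finrank F (Sel n true) + finrank F (Sel n false))) :
    ∃ m, κ m ∅ ≠ 0 :=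
  exists_ne_zero_of_zhangInduction Sel SelRel B κ m₁ hfin hA1 hA2 hA3 hA4 hA5 hA6 ∅ (by simp)

/-- **Sequential composition at ONE frame of the crux** (the `_of` of a METHOD skeleton for item 19574, in kernel
terms): given an HL frame `(W, K, Dt, β, ι)` at `p = 3`, Zhang data `(Sel, SelRel, B, κ, m₁)` satisfying (A1)–(A6),
and a REALISATION of the bottom-level classes — every non-zero `κ m ∅` is (the image of) a genuine Kolyvagin class
`c₁(n)` of some Kolyvagin–Heegner datum of Kolyvagin-prime conductor on the frame (`hreal`; in Zhang: `κ m ∅ = c(m, 1)`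
itself) — the conclusion of `ZhangSharpFrameAtThreeHL` holds at that frame. The ∀-frame statement «such data exist on
every Hoffstein–Luo frame of every A1 curve» is the ONE stub of the method skeleton (= the cell's memo chain at
`3 ∥ N`; NOT claimed here). CONDITIONAL on every binder; nothing is booked. [cite: WZhang2014, Thm. 9.1 and Thm. 9.3] -/
theorem kolyvaginClass_one_ne_zero_of_zhangInduction
    (W : WeierstrassCurve ℚ) [W.IsElliptic] [W.IsGloballyMinimal] [NeZero (W.conductorNorm ℤ)]
    (K : Type) [Field K] [NumberField K]
    (Dt : Literature.NumberTheory.EllipticCurves.ModularForms.ModularParametrizationData W (W.conductorNorm ℤ))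
    (β : ℤ) (ι : K →+* ℂ)
    -- Zhang data at this frame
    (Sel : Finset Q → Bool → Submodule F H) (SelRel : Finset Q → Set Q → Bool → Submodule F H)
    (B : Finset Q → Set Q) (κ : M → Finset Q → H) (m₁ : M)
    (hfin : ∀ (n : Finset Q) (S : Set Q) (μ : Bool), FiniteDimensional F (SelRel n S μ))
    (hA1 : ∀ (n : Finset Q) (μ : Bool) (c : H), c ∈ Sel n μ → c ≠ 0 →
      ∃ q, q ∉ n ∧ c ∉ Sel (insert q n) μ ∧ Sel (insert q n) μ ≤ Sel n μ ∧
        finrank F (Sel (insert q n) μ) + 1 = finrank F (Sel n μ) ∧ Sel (insert q n) (!μ) = Sel n (!μ))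
    (hA2 : ∀ (n : Finset Q) (q₁ q₂ : Q), q₁ ∉ n → q₂ ∉ insert q₁ n →
      q₂ ∉ B (insert q₂ (insert q₁ n)) → ∃ m, κ m n ≠ 0)
    (hA3 : ∀ (n : Finset Q), Even n.card → (∃ m, κ m n ≠ 0) →
      ∃ (s : Bool) (d : ℕ), finrank F (Sel n s) = d + 1 ∧ Sel n s = SelRel n (B n) s ∧
        finrank F (SelRel n (B n) (!s)) ≤ d)
    (hA4 : ∀ (n : Finset Q) (q : Q) (S : Set Q) (s : Bool), q ∉ n → q ∈ S → Sel n s ≤ SelRel (insert q n) S s)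
    (hA5 : ∀ (n : Finset Q), Even n.card → finrank F (Sel n true) + finrank F (Sel n false) = 1 → κ m₁ n ≠ 0)
    (hA6 : ∀ (n : Finset Q), Even n.card → Odd (finrank F (Sel n true) + finrank F (Sel n false)))
    -- realisation of the bottom-level classes as the frame's Kolyvagin classes mod 3
    (hreal : ∀ m, κ m ∅ ≠ 0 →
      ∃ (n : ℕ) (d : Literature.NumberTheory.EllipticCurves.KolyvaginHeegnerData Dt β ι n),
        Literature.NumberTheory.EllipticCurves.KolyvaginDescent.KolSupp
            (Literature.NumberTheory.EllipticCurves.Zhang2014.IsKolyvaginPrime (W.conductorNorm ℤ) W K 3) n ∧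
          d.kolyvaginClass Nat.prime_three 1 ≠ 0) :
    ∃ (n : ℕ) (d : Literature.NumberTheory.EllipticCurves.KolyvaginHeegnerData Dt β ι n),
      Literature.NumberTheory.EllipticCurves.KolyvaginDescent.KolSupp
          (Literature.NumberTheory.EllipticCurves.Zhang2014.IsKolyvaginPrime (W.conductorNorm ℤ) W K 3) n ∧
        d.kolyvaginClass Nat.prime_three 1 ≠ 0 := by
  obtain ⟨m, hm⟩ := exists_ne_zero_at_bottom_of_zhangInduction Sel SelRel B κ m₁ hfin hA1 hA2 hA3 hA4 hA5 hA6
  exact hreal m hm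


/-! ## Parity is not an input: (A6) from (A1) and the non-vanishing of the Selmer rank (Zhang Thm. 9.2) -/

/-- **Parity from rank lowering and a non-zero Selmer rank** (W. Zhang 2014, Thm. 9.2, «we finally remark how to
avoid the use of parity conjecture and actually deduce the parity conjecture from our argument»): if (A1) every
non-zero eigen-class is killed by raising the level at one new prime with the printed dimension bookkeeping, and
(A6⁰) the Selmer rank at an even level is never `0` (Thm. 7.1: `Sel = 0` forces `L(g/K,1) ≠ 0`, impossible at root
number `−1` — the rank-0 converse, same input family as (A5)), then the Selmer rank at every even level is ODD:
lowering twice from an even level of even rank `r ≥ 2` reaches an even level of rank `r − 2`, and `r = 0` is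
excluded. Only (A1) and (A6⁰) are used. [cite: WZhang2014, Thm. 9.2 (p. 242) and Thm. 7.1] -/
theorem odd_rank_of_rankLowering
    (Sel : Finset Q → Bool → Submodule F H)
    (hA1 : ∀ (n : Finset Q) (μ : Bool) (c : H), c ∈ Sel n μ → c ≠ 0 →
      ∃ q, q ∉ n ∧ c ∉ Sel (insert q n) μ ∧ Sel (insert q n) μ ≤ Sel n μ ∧
        finrank F (Sel (insert q n) μ) + 1 = finrank F (Sel n μ) ∧ Sel (insert q n) (!μ) = Sel n (!μ))
    (hA6₀ : ∀ (n : Finset Q), Even n.card → finrank F (Sel n true) + finrank F (Sel n false) ≠ 0) :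
    ∀ (n : Finset Q), Even n.card → Odd (finrank F (Sel n true) + finrank F (Sel n false)) := by
  suffices hmain : ∀ (k : ℕ) (n : Finset Q), finrank F (Sel n true) + finrank F (Sel n false) = k →
      Even n.card → Odd k from fun n hn ↦ hmain _ n rfl hn
  intro k
  induction k using Nat.strong_induction_on with
  | _ k ih =>
    intro n hk hn
    by_contra hkodd
    have hkeven : Even k := Nat.not_odd_iff_even.mp hkodd
    have hk0 : k ≠ 0 := hk ▸ hA6₀ n hn
    have hk2 : 2 ≤ k := by obtain ⟨t, ht⟩ := hkeven; omega
    -- a non-zero class in some eigenspace, lowered once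
    obtain ⟨μ, hμ⟩ : ∃ μ : Bool, 1 ≤ finrank F (Sel n μ) := by
      by_cases h : 1 ≤ finrank F (Sel n true)
      · exact ⟨true, h⟩
      · exact ⟨false, by omega⟩
    obtain ⟨c₁, hc₁, hc₁0⟩ := exists_mem_ne_zero_of_finrank_pos (S := Sel n μ) (by omega)
    obtain ⟨q₁, hq₁n, -, -, hrk₁, hneg₁⟩ := hA1 n μ c₁ hc₁ hc₁0
    have hsum := rank_symm Sel n μ
    have hsum₁ := rank_symm Sel (insert q₁ n) μ
    -- rank at n ∪ {q₁} is k − 1 ≥ 1: lower once more in an eigenspace of positive dimension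
    obtain ⟨μ', hμ'⟩ : ∃ μ' : Bool, 1 ≤ finrank F (Sel (insert q₁ n) μ') := by
      by_cases h : 1 ≤ finrank F (Sel (insert q₁ n) μ)
      · exact ⟨μ, h⟩
      · refine ⟨!μ, ?_⟩
        rw [hneg₁]
        omega
    obtain ⟨c₂, hc₂, hc₂0⟩ := exists_mem_ne_zero_of_finrank_pos (S := Sel (insert q₁ n) μ') (by omega)
    obtain ⟨q₂, hq₂n, -, -, hrk₂, hneg₂⟩ := hA1 (insert q₁ n) μ' c₂ hc₂ hc₂0
    have hsum₁' := rank_symm Sel (insert q₁ n) μ'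
    have hsum₂ := rank_symm Sel (insert q₂ (insert q₁ n)) μ'
    have hcard : (insert q₂ (insert q₁ n)).card = n.card + 2 := by
      rw [Finset.card_insert_of_notMem hq₂n, Finset.card_insert_of_notMem hq₁n]
    have heven₂ : Even (insert q₂ (insert q₁ n)).card := by
      obtain ⟨t, ht⟩ := hn
      exact ⟨t + 1, by rw [hcard]; omega⟩
    have hrank₂ : finrank F (Sel (insert q₂ (insert q₁ n)) true) +
        finrank F (Sel (insert q₂ (insert q₁ n)) false) + 2 = k := by
      rw [← hsum₂, hneg₂, ← hk, ← hsum, ← hneg₁] at *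
      omega
    have hodd₂ := ih (k - 2) (by omega) (insert q₂ (insert q₁ n)) (by omega) heven₂
    obtain ⟨t, ht⟩ := hkeven
    obtain ⟨t', ht'⟩ := hodd₂
    omega

/-- **Zhang's induction with parity DERIVED** — (A1)–(A5) and (A6⁰) «the Selmer rank at an even level is non-zero»
(Thm. 7.1 + root number −1) suffice: at every even level some class `κ m n` is non-zero. [cite: WZhang2014, §9 proof
of Thm. 9.1 and Thm. 9.2] -/
theorem exists_ne_zero_of_zhangInduction_of_rank_ne_zero
    (Sel : Finset Q → Bool → Submodule F H) (SelRel : Finset Q → Set Q → Bool → Submodule F H)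
    (B : Finset Q → Set Q) (κ : M → Finset Q → H) (m₁ : M)
    (hfin : ∀ (n : Finset Q) (S : Set Q) (μ : Bool), FiniteDimensional F (SelRel n S μ))
    (hA1 : ∀ (n : Finset Q) (μ : Bool) (c : H), c ∈ Sel n μ → c ≠ 0 →
      ∃ q, q ∉ n ∧ c ∉ Sel (insert q n) μ ∧ Sel (insert q n) μ ≤ Sel n μ ∧
        finrank F (Sel (insert q n) μ) + 1 = finrank F (Sel n μ) ∧ Sel (insert q n) (!μ) = Sel n (!μ))
    (hA2 : ∀ (n : Finset Q) (q₁ q₂ : Q), q₁ ∉ n → q₂ ∉ insert q₁ n →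
      q₂ ∉ B (insert q₂ (insert q₁ n)) → ∃ m, κ m n ≠ 0)
    (hA3 : ∀ (n : Finset Q), Even n.card → (∃ m, κ m n ≠ 0) →
      ∃ (s : Bool) (d : ℕ), finrank F (Sel n s) = d + 1 ∧ Sel n s = SelRel n (B n) s ∧
        finrank F (SelRel n (B n) (!s)) ≤ d)
    (hA4 : ∀ (n : Finset Q) (q : Q) (S : Set Q) (s : Bool), q ∉ n → q ∈ S → Sel n s ≤ SelRel (insert q n) S s)
    (hA5 : ∀ (n : Finset Q), Even n.card → finrank F (Sel n true) + finrank F (Sel n false) = 1 → κ m₁ n ≠ 0)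
    (hA6₀ : ∀ (n : Finset Q), Even n.card → finrank F (Sel n true) + finrank F (Sel n false) ≠ 0) :
    ∀ (n : Finset Q), Even n.card → ∃ m, κ m n ≠ 0 :=
  exists_ne_zero_of_zhangInduction Sel SelRel B κ m₁ hfin hA1 hA2 hA3 hA4 hA5
    (odd_rank_of_rankLowering Sel hA1 hA6₀)


/-! ## The sequential composition at a general prime `p` (Skinner–Zhang 2014 ∕ the erratum road at p ≥ 5) -/

/-- **Sequential composition at ONE frame, any prime `p`**: Zhang data `(Sel, SelRel, B, κ, m₁)` with (A1)–(A5) and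
a non-zero Selmer rank at even levels (A6⁰) — parity being DERIVED (`odd_rank_of_rankLowering`) — realised at the
bottom level by genuine Kolyvagin classes `c₁(n) = d.kolyvaginClass hp 1` of Kolyvagin-prime conductor for `(E, K, p)`
on the frame `(Dt, β, ι)`, give a non-zero mod-`p` Kolyvagin class on that frame. At `p ≥ 5` on the ♠ locus the data
are Skinner–Zhang 2014's (PRE) resp. W. Zhang 2014's (PUB, p ∤ N) theorems read as inputs; at `p = 3` they are the
cell's memo chain. CONDITIONAL on every binder; nothing is booked. [cite: WZhang2014, Thm. 9.1, Thm. 9.2, Thm. 9.3]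
[cite: SkinnerZhang2014, Thm. 1.3] -/
theorem kolyvaginClass_one_ne_zero_of_zhangInduction_at
    (W : WeierstrassCurve ℚ) [W.IsElliptic] [W.IsGloballyMinimal] [NeZero (W.conductorNorm ℤ)]
    (K : Type) [Field K] [NumberField K]
    (Dt : Literature.NumberTheory.EllipticCurves.ModularForms.ModularParametrizationData W (W.conductorNorm ℤ))
    (β : ℤ) (ι : K →+* ℂ) {p : ℕ} (hp : p.Prime)
    -- Zhang data at this frame
    (Sel : Finset Q → Bool → Submodule F H) (SelRel : Finset Q → Set Q → Bool → Submodule F H)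
    (B : Finset Q → Set Q) (κ : M → Finset Q → H) (m₁ : M)
    (hfin : ∀ (n : Finset Q) (S : Set Q) (μ : Bool), FiniteDimensional F (SelRel n S μ))
    (hA1 : ∀ (n : Finset Q) (μ : Bool) (c : H), c ∈ Sel n μ → c ≠ 0 →
      ∃ q, q ∉ n ∧ c ∉ Sel (insert q n) μ ∧ Sel (insert q n) μ ≤ Sel n μ ∧
        finrank F (Sel (insert q n) μ) + 1 = finrank F (Sel n μ) ∧ Sel (insert q n) (!μ) = Sel n (!μ))
    (hA2 : ∀ (n : Finset Q) (q₁ q₂ : Q), q₁ ∉ n → q₂ ∉ insert q₁ n →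
      q₂ ∉ B (insert q₂ (insert q₁ n)) → ∃ m, κ m n ≠ 0)
    (hA3 : ∀ (n : Finset Q), Even n.card → (∃ m, κ m n ≠ 0) →
      ∃ (s : Bool) (d : ℕ), finrank F (Sel n s) = d + 1 ∧ Sel n s = SelRel n (B n) s ∧
        finrank F (SelRel n (B n) (!s)) ≤ d)
    (hA4 : ∀ (n : Finset Q) (q : Q) (S : Set Q) (s : Bool), q ∉ n → q ∈ S → Sel n s ≤ SelRel (insert q n) S s)
    (hA5 : ∀ (n : Finset Q), Even n.card → finrank F (Sel n true) + finrank F (Sel n false) = 1 → κ m₁ n ≠ 0)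
    (hA6₀ : ∀ (n : Finset Q), Even n.card → finrank F (Sel n true) + finrank F (Sel n false) ≠ 0)
    -- realisation of the bottom-level classes as the frame's Kolyvagin classes mod p
    (hreal : ∀ m, κ m ∅ ≠ 0 →
      ∃ (n : ℕ) (d : Literature.NumberTheory.EllipticCurves.KolyvaginHeegnerData Dt β ι n),
        Literature.NumberTheory.EllipticCurves.KolyvaginDescent.KolSupp
            (Literature.NumberTheory.EllipticCurves.Zhang2014.IsKolyvaginPrime (W.conductorNorm ℤ) W K p) n ∧
          d.kolyvaginClass hp 1 ≠ 0) :
    ∃ (n : ℕ) (d : Literature.NumberTheory.EllipticCurves.KolyvaginHeegnerData Dt β ι n),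
      Literature.NumberTheory.EllipticCurves.KolyvaginDescent.KolSupp
          (Literature.NumberTheory.EllipticCurves.Zhang2014.IsKolyvaginPrime (W.conductorNorm ℤ) W K p) n ∧
        d.kolyvaginClass hp 1 ≠ 0 := by
  obtain ⟨m, hm⟩ := exists_ne_zero_of_zhangInduction_of_rank_ne_zero Sel SelRel B κ m₁ hfin hA1 hA2 hA3 hA4 hA5
    hA6₀ ∅ (by simp)
  exact hreal m hm

end Summit.BirchSwinnertonDyer.Rank1Residual.X11b.Three.Koly.ZhangInduction
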